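import Summits.AtomisticToContinuum.HydrodynamicLimit.Theses.BallwiseInvariantReferences
import HarnessLib

/-!
# Route `MourreKoopmanCharges` — posited objects of the crux line for `LinearToEntropyInBand`

Objects (no items, no named facts) shared by the stub files and the composition of the crux
`MourreKoopmanCharges.LinearToEntropyInBand` (item stmt-AtomisticToContinuum-17740, line `registered` =
`Cruxes/LinearToEntropyInBand/Lines/birth.lean`, skeleton v2 of lead prover-line-…-17740-c3-0), moved
into an importable `Theorems` module so that every stub helper file (`--supports
stmt-AtomisticToContinuum-17740`) and the eventual closing file share ONE copy of them:

* § 1 the PACKING-GUARDED truncation inputs of the line: `EnergyCurrentTailsBelow η` /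
  `EnergyCurrentTailsInBand` (the shared crux `BallwiseInvariantReferences.EnergyCurrentTails`,
  stmt-9235, with the re-typed Statement's guard `∀ t ∈ [0,T) ∀ x, ρ_t(x)σ³ < η` inserted after the
  solution hypothesis) and `FastCollisionThroughputBelow η` / `FastCollisionThroughputInBand` (the same
  for `BallwiseInvariantReferences.FastCollisionThroughput`, stmt-13022), with their sorry-free
  bookkeeping: antitonicity in the packing level and `unguarded ⇒ guarded` (registered bookkeeping stub
  `stub_objects` of the skeleton);
* § 2 the vocabulary of VISIBLE local flux-Gibbsianity in pressure form — `Cfg`, `FlowFamily`,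
  `ExponentFamily`, `PressureFamily`, `gibbsLaw`, `pressureOf`, `cone`, `Visible`, `visCore`,
  `visExponent`, `PressureVanishesR`, `VisibleFluxGibbsianity` — copied VERBATIM (names and bodies) from
  the registered skeleton of the sibling crux `BallwiseInvariantReferences.LocalFluxGibbsianity`
  (stmt-13021), `Cruxes/LocalFluxGibbsianity/Lines/birth.lean` (planner-skel-…-13021-0), whose
  `stub_visibleWindowPressure` is `PressureVanishesR (fun R => pressureOf (visExponent R))`.  Cruxes
  workfiles are not importable from `Theorems`, hence the copy; the two crux chains thereby share one
  typed repair candidate for 13021 (refuted-MISSTATED on paper as filed: jammed-cluster virial,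
  rattack-13021-0/g2 — the visible functional drops exactly the dense particles' currents).

Lean conventions (documented junk, all inherited from the 13021 item text): `x / 0 = 0` and `0⁻¹ = 0`
in the block fields (`w = ρ̄⁻¹ m̄` is `0` where the visible block density vanishes), `Real.log`/`deriv`
junk inside `hsCompressibility`, `Function.leftLim` / `finsum` junk off the Liouville-conull good set of
the flow (invisible under `particleLaw`), Bochner-integral junk `0` for a non-integrable flux density.
Nothing here restates the crux, the route's items or the Statement.  References: OllaVaradhanYau1993
(§3–4), Spohn1991 (Part I §3.3, §7.1), Yau1991, NachtergaeleYau2003, BuragoFerlegerKononenko1998.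
-/

noncomputable section

open MeasureTheory Filter Set
open scoped ENNReal Topology InnerProductSpace BigOperators

namespace Summit.AtomisticToContinuum.HydrodynamicLimit.Theorems.LTEInBand

open Summit.AtomisticToContinuum.HydrodynamicLimit.Theses

/-! ## § 1 Packing-guarded truncation inputs -/

/-- **Cubic uniform integrability of the energy current below packing level `η`** — the shared typed
crux `BallwiseInvariantReferences.EnergyCurrentTails` (stmt-AtomisticToContinuum-9235) with the re-typed
Statement's packing guard `∀ t ∈ [0,T) ∀ x, ρ_t(x)σ³ < η` inserted after the solution hypothesis: for
continuous positive profiles `∃ σ₀ ∀ σ ∈ (0,σ₀)`, for every classical hs-Euler solution on `[0,T)`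
WHOSE LOCAL PACKING STAYS BELOW `η` and every flow family, if the local Gibbs fields converge at
`t = 0` then `∀ t < T ∀ ε > 0 ∃ M N₀ ∀ N ≥ N₀ ∀ s ∈ [0,t]`, `E[(N+1)⁻¹ Σᵢ |vᵢ(s)|³ 𝟙{|vᵢ(s)| > M}] ≤ ε`. -/
def EnergyCurrentTailsBelow (η : ℝ) : Prop :=
  ∀ (a₀ θ₀ : Literature.MathematicalPhysics.KineticTheory.T3 → ℝ) (u₀ : Literature.MathematicalPhysics.KineticTheory.T3 → Literature.MathematicalPhysics.KineticTheory.V3), Continuous a₀ → Continuous θ₀ → Continuous u₀ → (∀ x, 0 < a₀ x) → (∀ x, 0 < θ₀ x) → ∃ σ₀ : ℝ, 0 < σ₀ ∧ ∀ σ : ℝ, 0 < σ → σ < σ₀ → ∀ (T : ℝ) (ρ θ : ℝ → Literature.MathematicalPhysics.KineticTheory.T3 → ℝ) (u : ℝ → Literature.MathematicalPhysics.KineticTheory.T3 → Literature.MathematicalPhysics.KineticTheory.V3), Literature.MathematicalPhysics.KineticTheory.IsHardSphereEulerSolution σ T ρ u θ → (∀ t ∈ Set.Ico 0 T, ∀ x,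 ρ t x * σ ^ 3 < η) → ∀ Φ : (N : ℕ) → Literature.Analysis.FluidPDE.HardSphereFlow (Literature.Analysis.FluidPDE.Torus.geometry (Fin 3)) (Literature.MathematicalPhysics.KineticTheory.hsDiameter σ N) (N + 1), Literature.MathematicalPhysics.KineticTheory.TendstoHydroFieldsAt (fun N => Literature.MathematicalPhysics.KineticTheory.localGibbsLaw σ a₀ u₀ θ₀ N (Φ N)) Φ ρ u θ 0 → ∀ t ∈ Set.Ico 0 T, ∀ ε : ℝ, 0 < ε → ∃ M : ℝ, ∃ N₀ : ℕ, ∀ N : ℕ, N₀ ≤ N → ∀ s ∈ Set.Icc 0 t, ∫⁻ z, ENNReal.ofReal (((N : ℝ) + 1)⁻¹ * ∑ i : Fin (N + 1), Set.indicator {v : Literature.MathematicalPhysics.KineticTheory.V3 | M < ‖v‖} (fun v => ‖v‖ ^ 3) (((Φ N).flow s z i).2)) ∂(Literature.MathematicalPhysics.KineticTheory.localGibbsLaw σ a₀ u₀ θ₀ N (Φ N)) ≤ ENNReal.ofReal ε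

/-- `EnergyCurrentTailsBelow η` for SOME packing level `η > 0` (the guarded, i.e. weakened, form of
stmt-9235; `∃ η` outermost as in the re-typed conjunct). -/
def EnergyCurrentTailsInBand : Prop :=
  ∃ η : ℝ, 0 < η ∧ EnergyCurrentTailsBelow η

/-- **Vanishing fast-collision throughput below packing level `η`** — the typed crux
`BallwiseInvariantReferences.FastCollisionThroughput` (stmt-AtomisticToContinuum-13022) with the same
packing guard inserted: for continuous positive profiles `∃ σ₀ ∀ σ ∈ (0,σ₀)`, for every guarded
classical solution and flow family, if the local Gibbs fields converge at `t = 0` then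
`∀ t < T ∀ η' > 0 ∃ K N₀ ∀ N ≥ N₀`: `(N+1)^(-4/3) E[Σᵢ Σ_(collisions s ≤ t)
𝟙(max(|vᵢ(s⁻)|,|vᵢ(s)|) > K)(1 + |vᵢ(s)+vᵢ(s⁻)|/2)|vᵢ(s) − vᵢ(s⁻)|] ≤ η'`. -/
def FastCollisionThroughputBelow (η : ℝ) : Prop :=
  ∀ (a₀ θ₀ : Literature.MathematicalPhysics.KineticTheory.T3 → ℝ) (u₀ : Literature.MathematicalPhysics.KineticTheory.T3 → Literature.MathematicalPhysics.KineticTheory.V3), Continuous a₀ → Continuous θ₀ → Continuous u₀ → (∀ x, 0 < a₀ x) → (∀ x, 0 < θ₀ x) → ∃ σ₀ : ℝ, 0 < σ₀ ∧ ∀ σ : ℝ, 0 < σ → σ < σ₀ → ∀ (T : ℝ) (ρ θ : ℝ → Literature.MathematicalPhysics.KineticTheory.T3 → ℝ) (u : ℝ → Literature.MathematicalPhysics.KineticTheory.T3 → Literature.MathematicalPhysics.KineticTheory.V3), Literature.MathematicalPhysics.KineticTheory.IsHardSphereEulerSolution σ T ρ u θ → (∀ t ∈ Set.Ico 0 T,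 ∀ x, ρ t x * σ ^ 3 < η) → ∀ Φ : (N : ℕ) → Literature.Analysis.FluidPDE.HardSphereFlow (Literature.Analysis.FluidPDE.Torus.geometry (Fin 3)) (Literature.MathematicalPhysics.KineticTheory.hsDiameter σ N) (N + 1), Literature.MathematicalPhysics.KineticTheory.TendstoHydroFieldsAt (fun N => Literature.MathematicalPhysics.KineticTheory.localGibbsLaw σ a₀ u₀ θ₀ N (Φ N)) Φ ρ u θ 0 → ∀ t ∈ Set.Ico 0 T, ∀ η' : ℝ, 0 < η' → ∃ K : ℝ, ∃ N₀ : ℕ, ∀ N : ℕ, N₀ ≤ N → ∫⁻ z, ENNReal.ofReal ((((N : ℝ) + 1) ^ (-(4 / 3 : ℝ))) * ∑ i : Fin (N + 1), ∑ᶠ s ∈ Literature.Analysis.FluidPDE.collisionTimes (Literature.Analysis.FluidPDE.Torus.geometry (Fin 3)) (Literature.MathematicalPhysics.KineticTheory.hsDiameter σ N) (fun s => (Φ N).flow s z) ∩ Set.Ioc 0 t, (if K < max ‖(Function.leftLim (fun s => (Φ N).flow s z) s i).2‖ ‖((Φ N).flow s z i).2‖ then (1 + ‖((Φ N).flow s z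 i).2 + (Function.leftLim (fun s => (Φ N).flow s z) s i).2‖ / 2) * ‖((Φ N).flow s z i).2 - (Function.leftLim (fun s => (Φ N).flow s z) s i).2‖ else 0)) ∂(Literature.MathematicalPhysics.KineticTheory.localGibbsLaw σ a₀ u₀ θ₀ N (Φ N)) ≤ ENNReal.ofReal η'

/-- `FastCollisionThroughputBelow η` for SOME packing level `η > 0`. -/
def FastCollisionThroughputInBand : Prop :=
  ∃ η : ℝ, 0 < η ∧ FastCollisionThroughputBelow η

/-- The guard is monotone in the packing level, so the guarded tails statement is ANTITONE: a solution
guarded at level `η' ≤ η` is guarded at level `η`. -/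
theorem energyCurrentTailsBelow_antitone {η η' : ℝ} (hle : η' ≤ η) :
    EnergyCurrentTailsBelow η → EnergyCurrentTailsBelow η' := by
  intro H a₀ θ₀ u₀ ha hθ hu hap hθp
  obtain ⟨σ₀, hσ₀, G⟩ := H a₀ θ₀ u₀ ha hθ hu hap hθp
  exact ⟨σ₀, hσ₀, fun σ hσ hσ' T ρ θ u hE hguard =>
    G σ hσ hσ' T ρ θ u hE fun t ht x => (hguard t ht x).trans_le hle⟩

/-- Antitonicity of the guarded fast-collision throughput in the packing level. -/
theorem fastCollisionThroughputBelow_antitone {η η' : ℝ} (hle : η' ≤ η) :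
    FastCollisionThroughputBelow η → FastCollisionThroughputBelow η' := by
  intro H a₀ θ₀ u₀ ha hθ hu hap hθp
  obtain ⟨σ₀, hσ₀, G⟩ := H a₀ θ₀ u₀ ha hθ hu hap hθp
  exact ⟨σ₀, hσ₀, fun σ hσ hσ' T ρ θ u hE hguard =>
    G σ hσ hσ' T ρ θ u hE fun t ht x => (hguard t ht x).trans_le hle⟩

/-- The unguarded shared crux stmt-9235 implies the guarded statement (take `η := 1`, ignore the
guard): the line's stub 2 WEAKENS `BallwiseInvariantReferences.EnergyCurrentTails`. -/
theorem energyCurrentTailsInBand_of_unguarded (h : BallwiseInvariantReferences.EnergyCurrentTails) :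
    EnergyCurrentTailsInBand := by
  refine ⟨1, one_pos, fun a₀ θ₀ u₀ ha hθ hu hap hθp => ?_⟩
  obtain ⟨σ₀, hσ₀, G⟩ := h a₀ θ₀ u₀ ha hθ hu hap hθp
  exact ⟨σ₀, hσ₀, fun σ hσ hσ' T ρ θ u hE _ => G σ hσ hσ' T ρ θ u hE⟩

/-- The unguarded shared crux stmt-13022 implies the guarded statement (take `η := 1`): the line's
stub 3 WEAKENS `BallwiseInvariantReferences.FastCollisionThroughput`. -/
theorem fastCollisionThroughputInBand_of_unguarded
    (h : BallwiseInvariantReferences.FastCollisionThroughput) : FastCollisionThroughputInBand := by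
  refine ⟨1, one_pos, fun a₀ θ₀ u₀ ha hθ hu hap hθp => ?_⟩
  obtain ⟨σ₀, hσ₀, G⟩ := h a₀ θ₀ u₀ ha hθ hu hap hθp
  exact ⟨σ₀, hσ₀, fun σ hσ hσ' T ρ θ u hE _ => G σ hσ hσ' T ρ θ u hE⟩

/-- **Registered bookkeeping stub `stub_objects` of the skeleton** (S0): the four bookkeeping facts the
composition `LinearToEntropyInBand_of_stubs` consumes — antitonicity of both guarded inputs in the
packing level, and `unguarded ⇒ guarded` for both. -/
theorem stub_objects : (∀ η η' : ℝ, η' ≤ η → Summit.AtomisticToContinuum.HydrodynamicLimit.Theorems.LTEInBand.EnergyCurrentTailsBelow η → Summit.AtomisticToContinuum.HydrodynamicLimit.Theorems.LTEInBand.EnergyCurrentTailsBelow η') ∧ (∀ η η' : ℝ, η' ≤ η → Summit.AtomisticToContinuum.HydrodynamicLimit.Theorems.LTEInBand.FastCollisionThroughputBelow η → Summit.AtomisticToContinuum.HydrodynamicLimit.Theorems.LTEInBand.FastCollisionThroughputBelow η') ∧ (Summit.AtomisticToContinuum.HydrodynamicLimit.Theses.BallwiseInvariantReferences.EnergyCurrentTails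 → Summit.AtomisticToContinuum.HydrodynamicLimit.Theorems.LTEInBand.EnergyCurrentTailsInBand) ∧ (Summit.AtomisticToContinuum.HydrodynamicLimit.Theses.BallwiseInvariantReferences.FastCollisionThroughput → Summit.AtomisticToContinuum.HydrodynamicLimit.Theorems.LTEInBand.FastCollisionThroughputInBand) :=
  ⟨fun _ _ h => energyCurrentTailsBelow_antitone h, fun _ _ h => fastCollisionThroughputBelow_antitone h,
    energyCurrentTailsInBand_of_unguarded, fastCollisionThroughputInBand_of_unguarded⟩

/-! ## § 2 Visible local flux-Gibbsianity (vocabulary of `Cruxes/LocalFluxGibbsianity/Lines/birth.lean`) -/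

/-- Phase points of `M+1` spheres on `𝕋³`. -/
abbrev Cfg (M : ℕ) := Fin (M + 1) → UnitAddTorus (Fin 3) × EuclideanSpace ℝ (Fin 3)

/-- Families of hard-sphere flows of `M+1` spheres of diameter `ε M` on `𝕋³`. -/
abbrev FlowFamily (ε : ℕ → ℝ) :=
  (M : ℕ) → Literature.Analysis.FluidPDE.HardSphereFlow
    (Literature.Analysis.FluidPDE.Torus.geometry (Fin 3)) (ε M) (M + 1)

/-- Exponent families `X(σ', θ, u, ε, Φ, A₀, A₄, A, K, L, k, M; z) : ℝ`. -/
abbrev ExponentFamily :=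
  (σ' θ : ℝ) → (u : EuclideanSpace ℝ (Fin 3)) → (ε : ℕ → ℝ) → FlowFamily ε →
    (A₀ A₄ : UnitAddTorus (Fin 3) → EuclideanSpace ℝ (Fin 3)) →
    (A : Fin 3 → UnitAddTorus (Fin 3) → EuclideanSpace ℝ (Fin 3)) → (K L k : ℝ) → (M : ℕ) → Cfg M → ℝ

/-- Pressure families `Λ(σ', θ, u, ε, Φ, A₀, A₄, A, K, L, k, M) : EReal`. -/
abbrev PressureFamily :=
  (σ' θ : ℝ) → (u : EuclideanSpace ℝ (Fin 3)) → (ε : ℕ → ℝ) → FlowFamily ε →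
    (A₀ A₄ : UnitAddTorus (Fin 3) → EuclideanSpace ℝ (Fin 3)) →
    (A : Fin 3 → UnitAddTorus (Fin 3) → EuclideanSpace ℝ (Fin 3)) → (K L k : ℝ) → ℕ → EReal

/-- The homogeneous flow-invariant canonical hard-sphere Gibbs law `G_M` (activity 1, drift `u`,
temperature `θ`, diameter `ε M`) — the reference measure of local flux-Gibbsianity (13021). -/
def gibbsLaw (θ : ℝ) (u : EuclideanSpace ℝ (Fin 3)) (ε : ℕ → ℝ) (Φ : FlowFamily ε) (M : ℕ) :
    Measure (Cfg M) :=
  Literature.Analysis.FluidPDE.particleLaw (Φ M) (Literature.Analysis.FluidPDE.canonicalDensity (Literature.Analysis.FluidPDE.Torus.geometry (Fin 3)) (ε M) (M + 1) (Literature.MathematicalPhysics.KineticTheory.localGibbsProfile (fun _ => 1) (fun _ => u) (fun _ => θ)))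

/-- The window pressure of an exponent family: `(M+1)⁻¹ log ∫ exp(X) dG_M` in `EReal`
(`ENNReal.log`, so `log 0 = ⊥`, `log ⊤ = ⊤`: an infinite exponential moment is NOT a freebie). -/
def pressureOf (X : ExponentFamily) : PressureFamily := fun σ' θ u ε Φ A₀ A₄ A K L k M =>
  ((((M : ℝ) + 1)⁻¹ : ℝ) : EReal) * ENNReal.log (∫⁻ z, ENNReal.ofReal (Real.exp (X σ' θ u ε Φ A₀ A₄ A K L k M z)) ∂(gibbsLaw θ u ε Φ M))

/-- The uncut cone-kernel at radius `a (M+1)^{-1/3}` (normalised: `∫ cone a M x · = 1`). -/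
def cone (a : ℝ) (M : ℕ) (x y : UnitAddTorus (Fin 3)) : ℝ :=
  3 / (Real.pi * (a * ((M : ℝ) + 1) ^ (-(1 / 3 : ℝ))) ^ 3) * max 0 (1 - Literature.Analysis.FluidPDE.Torus.euclidDist x y / (a * ((M : ℝ) + 1) ^ (-(1 / 3 : ℝ))))

/-- VISIBILITY of particle `i` in the configuration `z`: slow (`‖v_i‖ ≤ K`) AND locally dilute at the
mesoscopic scale `R (M+1)^{-1/3}`: the UNCUT cone-kernel density around `x_i` (all particles, self
included, normalised so that the mean density is `1`) is at most `3/2`.  Near-jammed clusters, droplets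
and slabs thicker than `~ R σ'²` layers are invisible. -/
def Visible (R K : ℝ) (M : ℕ) (z : Cfg M) (i : Fin (M + 1)) : Prop :=
  ‖(z i).2‖ ≤ K ∧ ((M : ℝ) + 1)⁻¹ * ∑ j, cone R M (z i).1 (z j).1 ≤ 3 / 2

/-- Visibility is decided classically (it guards `if … then … else` in the functionals). -/
instance instDecidableVisible (R K : ℝ) (M : ℕ) (z : Cfg M) (i : Fin (M + 1)) :
    Decidable (Visible R K M z i) :=
  Classical.dec _

/-- The VISIBLE core `X_vis`: the crux-13021 functional `τ⁻¹[∫₀^τ kin + Σ_coll coll − ∫₀^τ flux]` with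
every per-particle indicator `‖v_i‖ ≤ K` replaced by `Visible R K` (in `kin`; for both the pre- and
post-collisional state in `coll`; and inside the block fields `ρ̄, m̄, ē` of `flux`, which are then the
fields of the visible particles; equation of state `Z(min(ρ̄,2)σ'³)` kept). -/
def visCore (R : ℝ) : ExponentFamily := fun σ' _θ _u ε Φ A₀ A₄ A K L k M z =>
  let τ : ℝ := L * ((M : ℝ) + 1) ^ (-(1 / 3 : ℝ))
  let bk : UnitAddTorus (Fin 3) → UnitAddTorus (Fin 3) → ℝ := cone k M
  let kin : Cfg M → ℝ := fun z => ∑ i, if Visible R K M z i then ⟪A₀ (z i).1, (z i).2⟫_ℝ + (∑ j, ⟪A j (z i).1, (z i).2⟫_ℝ * (z i).2 j) + ⟪A₄ (z i).1, (z i).2⟫_ℝ * ‖(z i).2‖ ^ 2 / 2 else 0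
  let coll : Cfg M → Cfg M → ℝ := fun zl zr => ∑ i, (let Δ : EuclideanSpace ℝ (Fin 3) := (zr i).2 - (zl i).2; let ω : EuclideanSpace ℝ (Fin 3) := ‖Δ‖⁻¹ • Δ; if Visible R K M zl i ∧ Visible R K M zr i then ε M / 2 * ∫ r in (0 : ℝ)..1, ((∑ j, ⟪A j ((zr i).1 + Literature.Analysis.FunctionSpaces.Torus.proj (-(r * ε M) • ω)), ω⟫_ℝ * Δ j) + ⟪A₄ ((zr i).1 + Literature.Analysis.FunctionSpaces.Torus.proj (-(r * ε M) • ω)), ω⟫_ℝ * (‖(zr i).2‖ ^ 2 - ‖(zl i).2‖ ^ 2) / 2) else 0)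
  let flux : Cfg M → ℝ := fun z => ((M : ℝ) + 1) * ∫ x, (let ρ : ℝ := ((M : ℝ) + 1)⁻¹ * ∑ i, (if Visible R K M z i then bk x (z i).1 else 0); let m : EuclideanSpace ℝ (Fin 3) := ((M : ℝ) + 1)⁻¹ • ∑ i, (if Visible R K M z i then bk x (z i).1 • (z i).2 else 0); let e : ℝ := ((M : ℝ) + 1)⁻¹ * ∑ i, (if Visible R K M z i then bk x (z i).1 * ‖(z i).2‖ ^ 2 / 2 else 0); let w : EuclideanSpace ℝ (Fin 3) := ρ⁻¹ • m; let p : ℝ := ρ * (2 / 3 * (e / ρ - ‖w‖ ^ 2 / 2)) * Literature.MathematicalPhysics.KineticTheory.hsCompressibility (min ρ 2 * σ' ^ 3); ⟪A₀ x, m⟫_ℝ + (∑ j, (⟪A j x, m⟫_ℝ * w j + p * A j x j)) + ⟪A₄ x, w⟫_ℝ * (e + p))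
  τ⁻¹ * ((∫ s in (0 : ℝ)..τ, kin ((Φ M).flow s z)) + (∑ᶠ s ∈ Literature.Analysis.FluidPDE.collisionTimes (Literature.Analysis.FluidPDE.Torus.geometry (Fin 3)) (ε M) (fun s => (Φ M).flow s z) ∩ Set.Ioc 0 τ, coll (Function.leftLim (fun s => (Φ M).flow s z) s) ((Φ M).flow s z)) - ∫ s in (0 : ℝ)..τ, flux ((Φ M).flow s z))

/-- The doubled visible exponent `2 X_vis` (doubling = the Cauchy–Schwarz exponent of the 13021
split; immaterial since `X_vis` is linear in the test fields and `β₀` is existential). -/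
def visExponent (R : ℝ) : ExponentFamily := fun σ' θ u ε Φ A₀ A₄ A K L k M z =>
  2 * visCore R σ' θ u ε Φ A₀ A₄ A K L k M z

/-- The crux-13021 quantifier shell for an `R`-indexed pressure family, with the mesoscopic
visibility scale `R` quantified TOGETHER WITH the speed cut and BEFORE the window:
`∃σ₀ ∀box ∃β₀ ∀(σ',θ,u,ε,Φ, smooth fields of sup ≤ β₀) ∀δ ∃K₀ ∀K ≥ K₀ ∀R ≥ K₀ ∃L₀ ∀L ∃k₀ ∀k`. -/
def PressureVanishesR (P : ℝ → PressureFamily) : Prop :=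
  ∃ σ₀ : ℝ, 0 < σ₀ ∧ ∀ (σlo σhi θlo θhi U : ℝ), 0 < σlo → σhi < σ₀ → 0 < θlo → ∃ β₀ : ℝ, 0 < β₀ ∧ ∀ σ' ∈ Set.Icc σlo σhi, ∀ θ ∈ Set.Icc θlo θhi, ∀ u : EuclideanSpace ℝ (Fin 3), ‖u‖ ≤ U → ∀ ε : ℕ → ℝ, (∀ M, 0 < ε M) → Filter.Tendsto (fun M : ℕ => ((M : ℝ) + 1) * ε M ^ 3) Filter.atTop (nhds (σ' ^ 3)) → ∀ Φ : (M : ℕ) → Literature.Analysis.FluidPDE.HardSphereFlow (Literature.Analysis.FluidPDE.Torus.geometry (Fin 3)) (ε M) (M + 1), ∀ (A₀ A₄ : UnitAddTorus (Fin 3) → EuclideanSpace ℝ (Fin 3)) (A : Fin 3 → UnitAddTorus (Fin 3) → EuclideanSpace ℝ (Fin 3)), Literature.Analysis.FunctionSpaces.Torus.IsSmooth A₀ → Literature.Analysis.FunctionSpaces.Torus.IsSmooth A₄ → (∀ k, Literature.Analysis.FunctionSpaces.Torus.IsSmooth (A k)) → (∀ x, ‖A₀ x‖ ≤ β₀) →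 (∀ x, ‖A₄ x‖ ≤ β₀) → (∀ k x, ‖A k x‖ ≤ β₀) → ∀ δ : ℝ, 0 < δ → ∃ K₀ : ℝ, ∀ K ≥ K₀, ∀ R ≥ K₀, ∃ L₀ : ℝ, ∀ L ≥ L₀, ∃ k₀ : ℝ, ∀ k ≥ k₀, Filter.limsup (fun M : ℕ => P R σ' θ u ε Φ A₀ A₄ A K L k M) Filter.atTop ≤ (δ : EReal)

/-- **Visible local flux-Gibbsianity in pressure form** — the repair candidate of stmt-13021 typed by
planner-skel-13021 (`stub_visibleWindowPressure` there): `∃ σ₀ ∀ box ∃ β₀ ∀ (σ', θ, u, ε, Φ, smooth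
fields of sup ≤ β₀) ∀ δ > 0 ∃ K₀ ∀ K ≥ K₀ ∀ R ≥ K₀ ∃ L₀ ∀ L ≥ L₀ ∃ k₀ ∀ k ≥ k₀:
limsup_M (M+1)⁻¹ log ∫ exp(2 X_vis) dG_M ≤ δ`.  Locally invariant states near the homogeneous Gibbs law
carry VISIBLE (slow, locally dilute) block-recentred anomalous current at most `β₀⁻¹ ×` their specific
relative entropy.  An OPEN statement (the ergodic input for deterministic hard spheres); it is the
conclusion of the line's stub 1 and the first antecedent of its stub 4, never asserted here. -/
def VisibleFluxGibbsianity : Prop :=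
  PressureVanishesR (fun R => pressureOf (visExponent R))

end Summit.AtomisticToContinuum.HydrodynamicLimit.Theorems.LTEInBand

end
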